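import Mathlib
import HarnessLib
import HarnessLib.Audit
import Summits.MatrixMultiplication.Statement
import Literature.Computability.AlgebraicComplexity.AsymptoticSpectrum
import Literature.Computability.AlgebraicComplexity.SchoenhageTau
import Literature.Computability.AlgebraicComplexity.SchoenhageTauBini
import Literature.Computability.AlgebraicComplexity.FlatteningBound
import HarnessLib.Audit.Status.Attr

/-!
Route: SpechtRecoupling

DORMANT since 2026-08-20T16:45:01Z (reconciler: no traction for 5 d (last activity route-revised at 2026-08-15T16:21:33Z); parked, not closed — `ledger route dormant route-MatrixMultiplication-SpechtRecoupling --off` to reactivate) — unstaffed, not closed; items shared with open routes are served there. `ledger route dormant <id> --off` reactivates.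

# Route SpechtRecoupling — omega=2 iff the S_2n-isotypic channels of matrix multiplication on the
n-singlet space have border-rank rate 16

Card specht-recoupling-sandwich, sharpened to its extremal block. Schur–Weyl on the three legs U = V
= W = (ℂ²)^{⊗2n} of ⟨2,2,2⟩^{⊗2n} = ⟨U,V,W⟩
splits the power into blocks ⟨m_α,m_β,m_γ⟩ ⊠ (S_2n-channels of ⟨[α],[β],[γ]⟩), α,β,γ two-row; the
CENTRAL block α = β = γ = (n,n) has m = 1 and is the
matrix multiplication tensor ⟨Inv_2n, Inv_2n, Inv_2n⟩ ≅ ⟨Cat_n,Cat_n,Cat_n⟩ on the SL₂-singlet space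
Inv_2n ≅ Specht [n,n] (dim = Catalan(n)), cut out of the
power by the sl₂-Casimir Lagrange projector on each leg. S_2n acts on End(Inv_2n) = [n,n]⊗[n,n]
multiplicity-freely (Sym² = ⊕ [λ], λ ⊢ 2n with ≤ 4 parts
all even; Λ² = ⊕ [λ], exactly 4 odd parts: GarsiaWallachXinZabrocki2012 /
BrownVanwilligenburgZabrocki2010 eq. (1)), so the isotypic channels
K^{λμν} = Tr(P_λ Zᵀ · P_μ X · P_ν Y) are CANONICAL S_2n-invariants in [λ]⊗[μ]⊗[ν] with irreducible
parties and injective flattenings (the card's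
"recoupling invariants"; its cw_2 = [3,1]³ symbol is the N = 4 off-central instance, Strassen's
⟨2,2,2⟩ with its S_3 is the n = 2 central block).
It suffices to show X = CentralChannelsRateFour: every isotypic channel (e₁,e₂,e₃ primitive central
idempotents of ℂ[S_2n]) of the central block has
border rank ≤ C_ε·16^{(1+ε)n}. By the sandwich (channels are restrictions; the block is the sum of
its p(2n)³ = 2^{o(n)} channels) X ⟺ bR(⟨Cat_n⟩³) =
16^{n(1+o(1))} (target CatalanBorderRate) ⟺ ω = 2 (Bini; Cat_n ≥ 4ⁿ/(2n(n+1))).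
Lean: `∀ ε : ℝ, 0 < ε → ∃ C : ℝ, ∀ n : ℕ, let E : Matrix (Fin (2 * n) → Fin 2) (Fin (2 * n) → Fin 2)
ℂ := fun w w' => ((Finset.univ.filter fun i : Fin (2 * n) => w' i = 1 ∧ w = Function.update w' i
0).card : ℂ); let H : Matrix (Fin (2 * n) → Fin 2) (Fin (2 * n) → Fin 2) ℂ := Matrix.diagonal fun w
=> ((Finset.univ.filter fun i : Fin (2 * n) => w i = 0).card : ℂ) - ((Finset.univ.filter fun i : Fin
(2 * n) => w i = 1).card : ℂ); let Ω : Matrix (Fin (2 * n) → Fin 2) (Fin (2 * n) → Fin 2) ℂ := E *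
E.transpose + E.transpose * E + (1 / 2 : ℂ) • (H * H); let S : Matrix (Fin (2 * n) → Fin 2) (Fin (2
* n) → Fin 2) ℂ := (((List.range n).map fun k : ℕ => (1 : Matrix (Fin (2 * n) → Fin 2) (Fin (2 * n)
→ Fin 2) ℂ) - (2 * ((n : ℂ) - k) * ((n : ℂ) - k + 1))⁻¹ • Ω)).prod; let B : (Fin (2 * n) → Fin 2 ×
Fin 2) → (Fin (2 * n) → Fin 2 × Fin 2) → (Fin (2 * n) → Fin 2 × Fin 2) → ℂ := fun a b c => S (fun i
=> (a i).1) (fun i => (b i).1) * S (fun i => (b i).2) (fun i => (c i).1) * S (fun i => (a i).2) (fun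
i => (c i).2); let conv : (Equiv.Perm (Fin (2 * n)) → ℂ) → (Equiv.Perm (Fin (2 * n)) → ℂ) →
Equiv.Perm (Fin (2 * n)) → ℂ := fun c d σ => ∑ τ : Equiv.Perm (Fin (2 * n)), c τ * d (τ⁻¹ * σ); let
IsPrim : (Equiv.Perm (Fin (2 * n)) → ℂ) → Prop := fun e => (∀ σ τ : Equiv.Perm (Fin (2 * n)), e (τ *
σ * τ⁻¹) = e σ) ∧ conv e e = e ∧ e ≠ 0 ∧ ∀ f : Equiv.Perm (Fin (2 * n)) → ℂ, (∀ σ τ : Equiv.Perm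
(Fin (2 * n)), f (τ * σ * τ⁻¹) = f σ) → conv f f = f → conv f e = 0 ∨ conv f e = e; ∀ e₁ e₂ e₃ :
Equiv.Perm (Fin (2 * n)) → ℂ, IsPrim e₁ → IsPrim e₂ → IsPrim e₃ →
(Literature.Computability.AlgebraicComplexity.algBorderRank (fun a b c => ∑ σ : Equiv.Perm (Fin (2 *
n)), ∑ τ : Equiv.Perm (Fin (2 * n)), ∑ υ : Equiv.Perm (Fin (2 * n)), e₁ σ * e₂ τ * e₃ υ * B (a ∘ σ)
(b ∘ τ) (c ∘ υ)) : ℝ) ≤ C * (16 : ℝ) ^ ((1 + ε) * n)`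

## Assembly
Pure logic given the two glue supports: CentralChannelsRateFour and ChannelsToCatalan give
CatalanBorderRate; CatalanToOmega turns it into ω(ℂ) = 2 =
MatrixMultiplication (Statement is `omega ℂ = 2` by MatrixMultiplication_iff). Checked sorry-free in
Sketch2.lean (`fun h g k => k (g h)`). The standard
reductions hidden in the glue: Wedderburn for ℂ[S_2n], p(N) = 2^{o(N)}, rank–nullity for the singlet
space, Bini's theorem, Catalan asymptotics.

Rationale: WHY THIS LINE. Mechanism (card specht-recoupling-sandwich; representation theory of S_N imported
through Schur–Weyl duality, two-row Kronecker products and classical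
SO(4) = SL₂×SL₂ invariant theory): asymptotic rank of T is lim_N max over S_N-isotypic channels of
the border rank of T^{⊠N} (elementary sandwich,
frame of ChristandlVranaZuiddam2023 §3 and BurgisserIkenmeyer2011 — used there only for LOWER
bounds), so ω is decided by border ranks of canonical
S_N-invariant tensors. New here: (i) the extremal block is identified exactly — matrix
multiplication on the n-singlet space, an explicit integer
Casimir projector, Catalan size — so the whole of ω sits in ONE block with irreducible S_2n-legs;
(ii) its channels are multiplicity-free and split by
parity: the odd channels assemble to the structure tensor of 𝔰𝔬(Cat_n) (Lie bracket on Λ²_β Inv_2n),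
the even ones to the Jordan product on Sym²_β, each
alone already carrying ω (Siegel block embedding ⟨m,m,m⟩ ≤ T_𝔰𝔬(4m)), which brings Lie-algebra
complexity (de Groote–Heintz, BurgisserClausenShokrollahi1997
Thm 17.47; 111-equations of JelisiejewLandsbergPal2023) to bear on the calibration cruxes; (iii) the
symmetric-ansatz no-go (card's apolarity lemma,
here PowersOutsideSecantSpan / SymmetricRateSeven) says decompositions of the channels must BREAK
S_N — the opposite stance to card
schur-weyl-equivariant-kronecker and to the symmetry ansatz of
ChiantiniHauensteinIkenmeyerLandsbergOttaviani2018 / ConnerGesmundoLandsbergVenturaWang2020.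
Versus existing routes: AsymptoticSpectrum localises ω at ⟨2,2,2⟩ dually (spectral points),
AsymptoticRankCW at cw_2; this route localises it at explicit
S_2n-invariants with irreducible legs and supplies finite calibration objects (𝔰𝔬₅ at n = 3,
⟨14,14,14⟩ with 7 channel types at n = 4). Negatives index: empty.

RANKED CRUXES. #0 CatalanBorderRate (target) — border rank of matrix multiplication on the
Catalan-size singlet space has rate 16 per n: ∀ε>0 ∃C ∀n, bR(⟨Cat_n,Cat_n,Cat_n⟩) ≤ C·16^{(1+ε)n}
(ω_bR = 2 read along n ↦ Cat_n ≍ 4ⁿ n^{-3/2}; the central block of ⟨2,2,2⟩^{⊗2n} IS this tensor,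
padded). (why it might fail: Equivalent to ω = 2 (Bini, Blaser2013 Thm 6.6; Catalan ≍ 4ⁿ/n^{3/2}):
false iff ω > 2; best known ω < 2.371339 gives only rate 2^{2.3714·2} ≈ 26.8 per n.) [Blaser2013,
AlmanDuanVassilevskaWilliamsXuXuZhou2025, ChristandlVranaZuiddam2023,
BurgisserClausenShokrollahi1997]
#2 CentralChannelsRateFour (crux) — X of the thesis (card C1 at its extremal block): for every ε > 0
there is C with: for all n and all primitive central idempotents e₁,e₂,e₃ of ℂ[S_2n] (class
functions, convolution-idempotent, minimal), the channel (ρ(e₁)⊗ρ(e₂)⊗ρ(e₃))·B_n of the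
Casimir-projected central block B_n (S = ∏_{k<n}(1 − Ω/(2(n−k)(n−k+1))), Ω = EEᵀ+EᵀE+H²/2 on words
Fin 2n → Fin 2; B_n(a,b,c) = S(a₁,b₁)S(b₂,c₁)S(a₂,c₂); ρ = place permutation) has algBorderRank ≤
C·16^{(1+ε)n}. Nonzero channels: e_i = e_λ with λ ∈ {≤ 4 even parts} ∪ {4 odd parts}; each is an
S_2n-invariant in [λ]⊗[μ]⊗[ν] with irreducible legs and flattening ranks (f^λ,f^μ,f^ν) ≤ Cat_n² ≍
16ⁿ/n³, so for fat triples the claim is near-minimal border rank. [difficulty: open-problem] (why it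
might fail: ⟺ ω=2 via the sandwich; fat channels carry 4-row Kronecker invariants (covariants of
4×4×4 hypermatrices — wild), Kronecker CG maps have no Gelfand–Tsetlin form, and every nonzero
channel met so far is NOT cheap beyond minimal (𝔰𝔬₅ channel at n=3).) [ChristandlVranaZuiddam2023,
BurgisserIkenmeyer2011, GarsiaWallachXinZabrocki2012, doi:10.1142/s0218196712500221,
BrownVanwilligenburgZabrocki2010, arXiv:0809.3469, ConnerGesmundoLandsbergVentura2022, Blaser2013]
#3 SoBorderExcess (crux) — calibration of the odd channels (Lie reading): the structure tensor of
𝔰𝔬_m (basis E_ij − E_ji, i<j; entry = coefficient of X_z in [X_x,X_y]) has border rank uniformly NOT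
near-minimal: ∃c>0 ∀m≥3, bR(T_𝔰𝔬_m) ≥ (1+c)·m(m−1)/2. Via OddChannelIsSo the odd channel of B_n is
T_𝔰𝔬(Cat_n), so a proof fixes the constant-factor excess every channel construction must absorb on
the odd side (harmless for rates, fatal for 'all channels minimal ⟹ ω = 2 with polynomial
overhead'); bR(T_𝔰𝔬_m) ≥ (2−o(1))·dim would be the border analogue of de Groote–Heintz. [deps:
OddChannelIsSo] [difficulty: M] (why it might fail: T_𝔤 is 1-degenerate (all slice spaces of corank
≥ rk 𝔤): Strassen/End-closed equations are trivial there (JelisiejewLandsbergPal2023 §3) and bR can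
sink towards dim (Landsberg2017 Rem 5.6.3.4); only RANK ≥ 2dim−rk is known (BCS Thm 17.47); or it is
a mere corollary of the 111-equations.) [BurgisserClausenShokrollahi1997,
JelisiejewLandsbergPal2023, arXiv:2205.05713, Landsberg2017, LandsbergOttaviani2015,
LandsbergMichalek2018]
#4 SymmetricRateSeven (crux) — symmetry forces triviality (quantitative form of the card's stance
'decompositions must break S_N'): for every N ≥ 1, every rank decomposition of ⟨2,2,2⟩^{⊗N} whose
SET of rank-one terms is stable under the place-permutation action of S_N has at least 7^N terms
(Strassen^{⊗N} and the standard algorithm of ⟨2^N⟩ in the word basis are S_N-stable with 7^N resp.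
8^N terms). N = 1 is R(⟨2,2,2⟩) = 7 (Winograd1971, HopcroftKerr1971). [difficulty: L] (why it might
fail: An S_N-stable decomposition mixing unbalanced Young-orbit types with ≥ 7 parts (not excluded
by PowersOutsideSecantSpan) or a swap-symmetric rank-48 decomposition of ⟨4,4,4⟩ (N=2; rank 48 over
ℂ exists, symmetry unknown) refutes it; no lower-bound method sees symmetry.)
[ChiantiniHauensteinIkenmeyerLandsbergOttaviani2018, ConnerGesmundoLandsbergVenturaWang2020,
ConnerGesmundoLandsbergVentura2022, Winograd1971, HopcroftKerr1971, BurgisserIkenmeyer2011]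
#9 ChannelsToCatalan (support) — the sandwich glue: CentralChannelsRateFour → CatalanBorderRate.
Proof: primitive central idempotents of ℂ[S_2n] sum to 1 (Wedderburn–Maschke, Mathlib
IsSemisimpleRing.exists_algEquiv_pi_matrix_of_isAlgClosed / tree exists_algEquiv_pi_matrix) so B_n =
Σ_{λμν} channel(e_λ,e_μ,e_ν) with p(2n)³ terms, p(N) ≤ e^{π√(2N/3)} = 2^{o(N)} (elementary
Euler-product bound); algBorderRank subadditive; ⟨Cat_n,Cat_n,Cat_n⟩ ≤ B_n because S = id on ker E ∩
(weight 0) whose dimension is ≥ C(2n,n) − C(2n,n+1) = catalan n (rank–nullity; Ω = EF+FE+H²/2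
vanishes there since [E,F] = H) and inserting S thrice into ⟨2^{2n}⟩ restricts to ⟨L,L,L⟩ for any L
on which S = id. [difficulty: L] [ChristandlVranaZuiddam2023, Blaser2013, GoodmanWallachGTM255]
#9 CatalanToOmega (support) — CatalanBorderRate → ω(ℂ) = 2: Bini (Blaser2013_thm66_holds.cubic,
PROVED) gives ω ≤ log_{Cat_n}(C·16^{(1+ε)n}) for Cat_n ≥ 2; with (n+1)·catalan n = centralBinom n
and 4ⁿ ≤ 2n·centralBinom n (Mathlib) the right side tends to 2(1+ε); ε → 0 and ω ≥ 2
(Theorems/AsymptoticSpectrumOmegaGeTwo, PROVED) give ω = 2. [difficulty: provable-now] [Blaser2013,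
AlmanDuanVassilevskaWilliamsXuXuZhou2025]
#9 OddChannelIsSo (support) — Lie localisation: for n ≥ 1 the β-odd part O_n of the central block (β
= ε^{⊗2n}|Inv, symmetric nondegenerate; X^β = JXᵀJ, in indices a ↦ θa = (ā₂,ā₁) with sign
(−1)^{#1(a₁)+#0(a₂)}; O_n = antisymmetrise all three parties) and the structure tensor of 𝔰𝔬(catalan
n) restrict to each other (hence equal border rank): Tr-pairing of β-odd with β-even vanishes, so
O_n(Z,X,Y) = ½⟨Z,[X,Y]⟩ on 𝔰𝔬(Inv_2n,β) ≅ 𝔰𝔬_Cat_n(ℂ). Representation-theoretically O_n = Σ of the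
channels with λ,μ,ν all of 4 odd parts (Λ²[n,n]); verified exactly for n = 2,3 (Λ² is one isotypic
type: [1⁴], [3,1³]). [difficulty: L] [GarsiaWallachXinZabrocki2012,
BrownVanwilligenburgZabrocki2010, arXiv:0809.3469, BurgisserClausenShokrollahi1997,
GoodmanWallachGTM255]
#9 SoFiveNotMinimal (support) — first finite calibration (card C3 at the first nontrivial central
block n = 3 = ⟨5,5,5⟩ under S_6, channel types (6),(4,2),(2,2,2),(3,1,1,1) of dims 1,9,5,10): the
odd channel = T_𝔰𝔬₅ ∈ (ℂ¹⁰)^{⊗3} is not of minimal border rank, bR ≥ 11. Expected proof: T_𝔰𝔬₅ is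
concise (BCS Ex. 14.22) and 111-sparse (triple intersection = quasi-centroid triples = scalars, dim
1 < 10), so the 111-equations (JelisiejewLandsbergPal2023 §1, Prop 1.1) exclude border rank 10;
alternatively a p = 1 Koszul-flattening certificate as in the tree's CGLV certificates. [difficulty:
S] [JelisiejewLandsbergPal2023, arXiv:2205.05713, BurgisserClausenShokrollahi1997,
LandsbergOttaviani2015, ConnerGesmundoLandsbergVentura2022]
#9 PowersOutsideSecantSpan (support) — the card's apolarity lemma in invariant form: for all large
N, ⟨2,2,2⟩^{⊗N} is not in the linear span of the N-th Kronecker powers of tensors of rank ≤ 6 (so no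
S_N-equivariant decomposition into Young-orbit sums of rank-one tensors with ≤ 6 orbit parts exists,
since such orbit sums are coefficient extractions of (Σ_{i≤6} t_i s_i)^{⊗N}). Proof: span{S^{⊗N} :
R(S) ≤ 6} = (I(σ₆(Seg))_N)^⊥ inside Sym^N; bR(⟨2,2,2⟩) = 7 (Landsberg2005) gives a homogeneous
equation of σ₆ not vanishing at ⟨2,2,2⟩ (explicitly of degree 20, HauensteinIkenmeyerLandsberg2013),
hence N₀ ≤ 20. [difficulty: M] [Landsberg2005, HauensteinIkenmeyerLandsberg2013,
BurgisserIkenmeyer2011]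

TWO-LAYER PLAN. Foreseen glued splits (nothing filed now): CentralChannelsRateFour ⇐
EvenChannelsRateFour → OddChannelsRateFour → CentralChannelsRateFour (parity split,
Sym²_β/Λ²_β; each child alone is still ⟺ ω = 2 by the Jordan resp. Siegel embeddings, so the split
is for bookkeeping of constructions, k = 2); later
OddChannelsRateFour ⇐ (diagonal fat channels λ=μ=ν) → (mixed) once a first channel family closes;
SoBorderExcess ⇐ (Koszul-flattening rank of T_𝔰𝔬_m on a
3-plane) → (conciseness/111-space of T_𝔤) → SoBorderExcess.

KILL CRITERIA. ω > 2 in any form (a universal spectral point F with F(⟨2,2,2⟩) > 4, route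
AsymptoticSpectrum; a superquadratic border-rank bound, route
BorderRankLowerBound) refutes CatalanBorderRate and CentralChannelsRateFour at once: close
refuted:CentralChannelsRateFour. SymmetricRateSeven refuted (a
symmetric sub-7^N decomposition) does NOT close the route — it re-ranks it upward and hands the
witness to card schur-weyl-equivariant-kronecker;
SoBorderExcess either way only calibrates (drop if refuted). The route is mooted (superseded) if
AsymptoticSpectrum's AThesis or AsymptoticRankCW's BThesis is
proved. Dormancy trigger: the novelty audit finds the central-block/𝔰𝔬 localisation in print AND no
channel family beyond the trivial ones gets a
rate-16 construction within tenure.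

NOT DECOMPOSED YET. The n = 4 channel table (⟨14,14,14⟩ under S_8: 7 types
(8),(6,2),(4,4),(4,2,2),(2,2,2,2) | (5,1,1,1),(3,3,1,1), dims 1,20,14,56,14 | 35,56; Koszul lower /
numerical upper bounds per channel) — a kit computation to be requested only after SoFiveNotMinimal
lands; explicit seminormal (Young-orthogonal, Dyck-path)
models of the channels and the three-qubit-covariant description of the two-row sub-blocks (card C2)
— constructions, not statements; the even (Jordan)
analogue of SoBorderExcess; p(N) = 2^{o(N)} and 'sum of primitive central idempotents = 1' as
separate Literature lemmas (they are inside ChannelsToCatalan);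
any laser-method or spectral-point content (other routes).

CHEAPEST FALSIFIER. (a) Lookup: is "⟨2,2,2⟩^{⊗2n} ⊵ ⟨Cat_n⟩ on SL₂-singlets with its S_2n-channel/𝔰𝔬
parity structure" already in print (searched: no; see Novelty) — if yes the
route is graded known and goes dormant. (b) Computation already run here (exact arithmetic, folder
/tmp/chk.py log in NOTES.md): rank S_n = Catalan(n) and
S_n idempotent for n ≤ 3; End(Inv_2n) multiplicity-free with isotypic dims [1,1,2] (n=2), [1,5,9,10]
(n=3), Λ²_β a single type — had any of these failed the
thesis would have been mis-specified. (c) Next cheapest: the 111-space of T_𝔰𝔬₅ (10×10×10 linear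
algebra) for SoFiveNotMinimal, and a swap-symmetric ALS
search for rank-48 decompositions of ⟨4,4,4⟩ against SymmetricRateSeven at N = 2.

NUMBERS. Cat_n = 1,1,2,5,14,42,…; (n+1)Cat_n = C(2n,n), 4ⁿ/(2n) ≤ C(2n,n) ≤ 4ⁿ. Central block sizes:
n=2 ⟨2,2,2⟩ (R = bR = 7), n=3 ⟨5,5,5⟩ (bR ≥ 2·25−5 = 45 by
LandsbergOttaviani2015; R ≤ 93? unknown exactly), n=4 ⟨14,14,14⟩. Channel types = p₄(n)+p₄(n−2) =
3,4,7,9,… . Rate targets: 16 per n for bR of channels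
(flattening ranks ≤ Cat_n² ≍ 16ⁿ/n³); known ω < 2.371339 (AlmanDuanVassilevskaWilliamsXuXuZhou2025)
⟹ rate ≤ 2^{4.743} ≈ 26.8. Lie side: R(𝔤) ≥ 2 dim 𝔤 − rk 𝔤
(BCS Thm 17.47: R(𝔰𝔬₅) ≥ 18), bR(T_𝔰𝔬₃) = bR(Λ³ℂ³) = 5 (ConnerHuangLandsberg2020), dim 𝔰𝔬(Cat_n) =
Cat_n(Cat_n−1)/2. Items at open: 10 (3 cruxes).

DEFINITION REQUESTS. None blocking (everything is inlined over Matrix / Equiv.Perm / algBorderRank /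
TensorRestrictsTo / catalan). Convenience notions a grounder may vendor to
shorten the signatures: `singletProjector n` (the Casimir Lagrange product S), `centralBlock n`,
`isotypicChannel n e₁ e₂ e₃`, `IsPrimitiveCentralIdempotent`
(class function, convolution-idempotent, minimal), `soStructureTensor m` — topic
Summits/MatrixMultiplication/MatrixMultiplication/Theorems. Facts wanted as
hypotheses: 111-equations for border rank ≤ m (JelisiejewLandsbergPal2023 §1 / [MR4332674]); s_(n,n)
∗ s_(n,n) = rug(4 parts all even or all odd)
(GarsiaWallachXinZabrocki2012; BrownVanwilligenburgZabrocki2010 eq. (1)); p(N) ≤ exp(π√(2N/3)).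

Novelty: Searches (2026-08-15; the local searchd was down for most of the session, arXiv/OpenAlex/S2
rate-limited, galaxy queued out — logged in NOTES.md):
`lit search --hybrid "Schur-Weyl duality Kronecker power matrix multiplication tensor isotypic
border rank"` (8 docs: BCS97, Landsberg2017, Michałek–Sturmfels,
AlmanVW laser — none with an isotypic splitting used for UPPER bounds); `lit search --source zbmath
"Catalan Kronecker products"` (→ BrownVanwilligenburgZabrocki2010,
arXiv:0809.3469, read p.3: eq.(1) s_(d,d)∗s_(d,d) = rug(4 parts all even or all odd), from GWXZ;
motivated by 4-qubit SL(2)^4 invariants); `… "Kronecker product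
two-row shapes"` (Rosas 2001 arXiv:math/0001084, Remmel–Whitehead 1994, Briand–Orellana–Rosas
arXiv:0812.0861); `… "concise tensors of minimal border rank"`
(JelisiejewLandsbergPal2023 arXiv:2205.05713, read §1: 111-abundance necessary for minimal border
rank; arXiv:2604.24879; arXiv:2411.05721); `… "border rank
structure tensor simple Lie algebra"` (only Landsberg 2012 book); `lit read book:burgisser1997
--grep 'Lie algebra'` (Thm 17.47 de Groote–Heintz, Ex. 14.22);
the card's own audit (arXiv:1709.07851, 1011.1350, 1210.8368, 1909.04785, 2404.06427).
Nearest prior art found: ChristandlVranaZuiddam2023 (arXiv:1709.07851 §3: isotypic/moment-polytope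
analysis of Kronecker powers → quantum functionals, LOWER
bounds on asymptotic rank) and BurgisserIkenmeyer2011 (isotypic analysis of ⟨n,n,n⟩ and unit-tensor
orbit closures for border-rank lower bounds);
Con  [refs: 0809.3469, math/0001084, 0812.0861, 2205.05713, 2604.24879, 2411.05721, 1709.07851, book:burgisser1997, Landsberg2017, ChristandlVranaZuiddam2023, BurgisserIkenmeyer2011, ConnerGesmundoLandsbergVenturaWang2020, ConnerGesmundoLandsbergVentura2022]

Barriers (technique_class: schur-weyl-blocks, isotypic-sandwich, lie-channel): - technique_class: schur-weyl-blocks, isotypic-sandwich, lie-channel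
- Literature.Barriers.MatrixMultiplication.IrreversibilityBarrier: does not apply — no fixed
intermediate tensor other than ⟨2,2,2⟩ itself is powered (i(⟨2,2,2⟩) = 1; CVZ Thm 9 is void at a
matrix multiplication tensor).
- Literature.Barriers.MatrixMultiplication.UniversalMethodBarrier: does not apply for the same
reason (Alman2021 Thm 1.3 bounds ω_u(T) for T ≠ matrix multiplication; here T = ⟨2,2,2⟩, S̃ =
R̃-unobstructed).
- Literature.Barriers.MatrixMultiplication.UnstableTensorBarrier: does not apply — ⟨Cat_n⟩ and its
channels are restrictions of a semistable tensor power; no unstable/non-semisimple structure tensor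
is used for an UPPER bound (T_𝔰𝔬 enters only on the calibration/lower side).
- Literature.Barriers.MatrixMultiplication.InfimumNotMinimumBarrier: respected — every statement is
a rate (∀ε ∃C), no single finite decomposition is asked to certify ω = 2; finite items
(SoFiveNotMinimal, n = 4 table) are calibration only.
- Literature.Barriers.MatrixMultiplication.LinearRankMethodBarrier: APPLIES to the negative side:
determinantal methods certify ≤ 6m−4 on (ℂ^m)^⊗3, so no channel can be shown to have rate > 16 (that
would be ω > 2) and even SoBorderExcess must stay within constant factors — which is exactly how it
is stated ((1+c)·dim, inside the cap); the positive cruxes are constructions, untouched.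
- Literature.Barriers.MatrixMultiplication.YoungSubgroupBarrier: not in its scope (it bars TPP tri

Novelty grade: new-combination — NEW-COMBINATION (route-review refuter 1a4b8c33; = card grade by novelty-audit-MM-2-0). SEARCHED (local searchd rc75, S2 429, arXiv/zbMATH API 0 rows on compound queries — logged): galaxy-pdf intelligent 'ω via border ranks of S_N-isotypic Schur–Weyl blocks of ⟨2,2,2⟩^{⊗N} / SL₂-singlet Catalan block (refuter refuter-rreview-route-AtomisticToContinu-1a4b8c33-0, 2026-08-15T14:05:13Z; prior: arXiv:1709.07851, arXiv:1011.1350, arXiv:1210.8368, arXiv:0809.3469, GarsiaWallachXinZabrocki2012, book:burgisser1997 Thm 17.47, arXiv:2205.05713, arXiv:2506.13242, arXiv:2506.13131)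

History (route lifecycle, newest last):
- 2026-08-20T16:45:01Z · DORMANT — reconciler: no traction for 5 d (last activity route-revised at 2026-08-15T16:21:33Z); parked, not closed — `ledger route dormant route-MatrixMultiplication-Spe (operator:999:4078770)

sub-problem: MatrixMultiplication · status: dormant · opened planner-plancard-MatrixMultiplication-MatrixM-ce344b08-0 2026-08-15T11:52:42Z · rev 1 · ledger route-MatrixMultiplication-SpechtRecoupling
GENERATED by the gate from the ledger (D-0016/17). Provers cite these decls: `theorem foo : Summit.MatrixMultiplication.MatrixMultiplication.Theses.SpechtRecoupling.<Decl> := …` in Summits/MatrixMultiplication/MatrixMultiplication/Theorems/<Name>.lean.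
-/

namespace Summit.MatrixMultiplication.MatrixMultiplication.Theses.SpechtRecoupling

open scoped BigOperators Topology Manifold Classical MeasureTheory ProbabilityTheory Matrix InnerProductSpace ComplexConjugate ContinuousMap
open Filter Set Function TopologicalSpace MeasureTheory

attribute [summit_statement] _root_.MatrixMultiplication

/-- item stmt-MatrixMultiplication-6793 · target · rank 0 · open · by planner
why it might fail: Equivalent to ω = 2 (Bini, Blaser2013 Thm 6.6; Catalan ≍ 4ⁿ/n^{3/2}): false iff ω > 2; best known ω < 2.371339 gives only rate 2^{2.3714·2} ≈ 26.8 per n.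
sources: Blaser2013, AlmanDuanVassilevskaWilliamsXuXuZhou2025, ChristandlVranaZuiddam2023, BurgisserClausenShokrollahi1997
[target] border rank of matrix multiplication on the Catalan-size singlet space has rate 16 per n:
∀ε>0 ∃C ∀n, bR(⟨Cat_n,Cat_n,Cat_n⟩) ≤ C·16^{(1+ε)n} (ω_bR = 2 read along n ↦ Cat_n ≍ 4ⁿ n^{-3/2};
the central block of ⟨2,2,2⟩^{⊗2n} IS this tensor, padded). -/
@[route_item "route-MatrixMultiplication-SpechtRecoupling"]
def CatalanBorderRate : Prop :=
  ∀ ε : ℝ, 0 < ε → ∃ C : ℝ, ∀ n : ℕ, (Literature.Computability.AlgebraicComplexity.algBorderRank (Literature.Computability.AlgebraicComplexity.matMulTensor ℂ (catalan n) (catalan n) (catalan n)) : ℝ) ≤ C * (16 : ℝ) ^ ((1 + ε) * n)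

/-- item stmt-MatrixMultiplication-6794 · crux · rank 2 · open · by planner
why it might fail: ⟺ ω=2 via the sandwich; fat channels carry 4-row Kronecker invariants (covariants of 4×4×4 hypermatrices — wild), Kronecker CG maps have no Gelfand–Tsetlin form, and every nonzero channel met so far is NOT cheap beyond minimal (𝔰𝔬₅ channel at n=3).
sources: ChristandlVranaZuiddam2023, BurgisserIkenmeyer2011, GarsiaWallachXinZabrocki2012, doi:10.1142/s0218196712500221, BrownVanwilligenburgZabrocki2010, arXiv:0809.3469
[crux] X of the thesis (card C1 at its extremal block): for every ε > 0 there is C with: for all n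
and all primitive central idempotents e₁,e₂,e₃ of ℂ[S_2n] (class functions, convolution-idempotent,
minimal), the channel (ρ(e₁)⊗ρ(e₂)⊗ρ(e₃))·B_n of the Casimir-projected central block B_n (S =
∏_{k<n}(1 − Ω/(2(n−k)(n−k+1))), Ω = EEᵀ+EᵀE+H²/2 on words Fin 2n → Fin 2; B_n(a,b,c) =
S(a₁,b₁)S(b₂,c₁)S(a₂,c₂); ρ = place permutation) has algBorderRank ≤ C·16^{(1+ε)n}. Nonzero
channels: e_i = e_λ with λ ∈ {≤ 4 even parts} ∪ {4 odd parts}; each is an S_2n-invariant in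
[λ]⊗[μ]⊗[ν] with irreducible legs and flattening ranks (f^λ,f^μ,f^ν) ≤ Cat_n² ≍ 16ⁿ/n³, so for fat
triples the claim is near-minimal border rank. [difficulty: open-problem] -/
@[route_item "route-MatrixMultiplication-SpechtRecoupling", crux]
def CentralChannelsRateFour : Prop :=
  ∀ ε : ℝ, 0 < ε → ∃ C : ℝ, ∀ n : ℕ, let E : Matrix (Fin (2 * n) → Fin 2) (Fin (2 * n) → Fin 2) ℂ := fun w w' => ((Finset.univ.filter fun i : Fin (2 * n) => w' i = 1 ∧ w = Function.update w' i 0).card : ℂ); let H : Matrix (Fin (2 * n) → Fin 2) (Fin (2 * n) → Fin 2) ℂ := Matrix.diagonal fun w => ((Finset.univ.filter fun i : Fin (2 * n) => w i = 0).card : ℂ) - ((Finset.univ.filter fun i : Fin (2 * n) => w i = 1).card : ℂ); let Ω : Matrix (Fin (2 * n) → Fin 2) (Fin (2 * n) → Fin 2) ℂ := E * E.transpose + E.transpose * E + (1 / 2 : ℂ) • (H * H); let S : Matrix (Fin (2 * n) → Fin 2) (Fin (2 * n) → Fin 2) ℂ := (((List.range n).map fun k : ℕ => (1 : Matrix (Fin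 (2 * n) → Fin 2) (Fin (2 * n) → Fin 2) ℂ) - (2 * ((n : ℂ) - k) * ((n : ℂ) - k + 1))⁻¹ • Ω)).prod; let B : (Fin (2 * n) → Fin 2 × Fin 2) → (Fin (2 * n) → Fin 2 × Fin 2) → (Fin (2 * n) → Fin 2 × Fin 2) → ℂ := fun a b c => S (fun i => (a i).1) (fun i => (b i).1) * S (fun i => (b i).2) (fun i => (c i).1) * S (fun i => (a i).2) (fun i => (c i).2); let conv : (Equiv.Perm (Fin (2 * n)) → ℂ) → (Equiv.Perm (Fin (2 * n)) → ℂ) → Equiv.Perm (Fin (2 * n)) → ℂ := fun c d σ => ∑ τ : Equiv.Perm (Fin (2 * n)), c τ * d (τ⁻¹ * σ); let IsPrim : (Equiv.Perm (Fin (2 * n)) → ℂ) → Prop := fun e => (∀ σ τ : Equiv.Perm (Fin (2 * n)), e (τ * σ * τ⁻¹) = e σ) ∧ conv e e = e ∧ e ≠ 0 ∧ ∀ f : Equiv.Perm (Fin (2 * n)) → ℂ, (∀ σ τ : Equiv.Perm (Fin (2 * n)), f (τ * σ * τ⁻¹) = f σ) → conv f f = f → conv f e = 0 ∨ conv f e =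 e; ∀ e₁ e₂ e₃ : Equiv.Perm (Fin (2 * n)) → ℂ, IsPrim e₁ → IsPrim e₂ → IsPrim e₃ → (Literature.Computability.AlgebraicComplexity.algBorderRank (fun a b c => ∑ σ : Equiv.Perm (Fin (2 * n)), ∑ τ : Equiv.Perm (Fin (2 * n)), ∑ υ : Equiv.Perm (Fin (2 * n)), e₁ σ * e₂ τ * e₃ υ * B (a ∘ σ) (b ∘ τ) (c ∘ υ)) : ℝ) ≤ C * (16 : ℝ) ^ ((1 + ε) * n)

/-- item stmt-MatrixMultiplication-6795 · crux · rank 3 · open · by planner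
why it might fail: T_𝔤 is 1-degenerate (all slice spaces of corank ≥ rk 𝔤): Strassen/End-closed equations are trivial there (JelisiejewLandsbergPal2023 §3) and bR can sink towards dim (Landsberg2017 Rem 5.6.3.4); only RANK ≥ 2dim−rk is known (BCS Thm 17.47); or it is a mere corollary of the 111-equations.
sources: BurgisserClausenShokrollahi1997, JelisiejewLandsbergPal2023, arXiv:2205.05713, Landsberg2017, LandsbergOttaviani2015, LandsbergMichalek2018
[crux] calibration of the odd channels (Lie reading): the structure tensor of 𝔰𝔬_m (basis E_ij −
E_ji, i<j; entry = coefficient of X_z in [X_x,X_y]) has border rank uniformly NOT near-minimal: ∃c>0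
∀m≥3, bR(T_𝔰𝔬_m) ≥ (1+c)·m(m−1)/2. Via OddChannelIsSo the odd channel of B_n is T_𝔰𝔬(Cat_n), so a
proof fixes the constant-factor excess every channel construction must absorb on the odd side
(harmless for rates, fatal for 'all channels minimal ⟹ ω = 2 with polynomial overhead'); bR(T_𝔰𝔬_m)
≥ (2−o(1))·dim would be the border analogue of de Groote–Heintz. [deps: OddChannelIsSo] [difficulty:
M] -/
@[route_item "route-MatrixMultiplication-SpechtRecoupling"]
def SoBorderExcess : Prop :=
  ∃ c : ℝ, 0 < c ∧ ∀ m : ℕ, 3 ≤ m → (1 + c) * ((m * (m - 1) / 2 : ℕ) : ℝ) ≤ (Literature.Computability.AlgebraicComplexity.algBorderRank (fun z x y : {p : Fin m × Fin m // p.1 < p.2} => (((Matrix.single x.1.1 x.1.2 (1 : ℂ) - Matrix.single x.1.2 x.1.1 1) * (Matrix.single y.1.1 y.1.2 (1 : ℂ) - Matrix.single y.1.2 y.1.1 1) - (Matrix.single y.1.1 y.1.2 (1 : ℂ) - Matrix.single y.1.2 y.1.1 1) * (Matrix.single x.1.1 x.1.2 (1 : ℂ) - Matrix.single x.1.2 x.1.1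 1) : Matrix (Fin m) (Fin m) ℂ)) z.1.1 z.1.2) : ℝ)

/-- item stmt-MatrixMultiplication-6796 · crux · rank 4 · open · by planner
why it might fail: An S_N-stable decomposition mixing unbalanced Young-orbit types with ≥ 7 parts (not excluded by PowersOutsideSecantSpan) or a swap-symmetric rank-48 decomposition of ⟨4,4,4⟩ (N=2; rank 48 over ℂ exists, symmetry unknown) refutes it; no lower-bound method sees symmetry.
sources: ChiantiniHauensteinIkenmeyerLandsbergOttaviani2018, ConnerGesmundoLandsbergVenturaWang2020, ConnerGesmundoLandsbergVentura2022, Winograd1971, HopcroftKerr1971, BurgisserIkenmeyer2011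
[crux] symmetry forces triviality (quantitative form of the card's stance 'decompositions must break
S_N'): for every N ≥ 1, every rank decomposition of ⟨2,2,2⟩^{⊗N} whose SET of rank-one terms is
stable under the place-permutation action of S_N has at least 7^N terms (Strassen^{⊗N} and the
standard algorithm of ⟨2^N⟩ in the word basis are S_N-stable with 7^N resp. 8^N terms). N = 1 is
R(⟨2,2,2⟩) = 7 (Winograd1971, HopcroftKerr1971). [difficulty: L] -/
@[route_item "route-MatrixMultiplication-SpechtRecoupling"]
def SymmetricRateSeven : Prop :=
  ∀ N : ℕ, 1 ≤ N → ∀ r : ℕ, ∀ u v w : Fin r → (Fin N → Fin 2 × Fin 2) → ℂ, Literature.Computability.AlgebraicComplexity.kroneckerPow (Literature.Computability.AlgebraicComplexity.matMulTensor ℂ 2 2 2) N = ∑ ρ, Literature.Computability.AlgebraicComplexity.triad (u ρ) (v ρ) (w ρ) → (∀ σ : Equiv.Perm (Fin N), ∃ π : Equiv.Perm (Fin r), ∀ ρ : Fin r, Literature.Computability.AlgebraicComplexity.triad (u (π ρ)) (v (π ρ)) (w (π ρ)) = Literature.Computability.AlgebraicComplexity.triad (fun a : (Fin N → Fin 2 ×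 Fin 2) => u ρ (a ∘ σ)) (fun b : (Fin N → Fin 2 × Fin 2) => v ρ (b ∘ σ)) (fun c : (Fin N → Fin 2 × Fin 2) => w ρ (c ∘ σ))) → 7 ^ N ≤ r

/-- item stmt-MatrixMultiplication-6797 · support · rank 9 · open · by planner
sources: ChristandlVranaZuiddam2023, Blaser2013, GoodmanWallachGTM255
[support] the sandwich glue: CentralChannelsRateFour → CatalanBorderRate. Proof: primitive central
idempotents of ℂ[S_2n] sum to 1 (Wedderburn–Maschke, Mathlib
IsSemisimpleRing.exists_algEquiv_pi_matrix_of_isAlgClosed / tree exists_algEquiv_pi_matrix) so B_n =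
Σ_{λμν} channel(e_λ,e_μ,e_ν) with p(2n)³ terms, p(N) ≤ e^{π√(2N/3)} = 2^{o(N)} (elementary
Euler-product bound); algBorderRank subadditive; ⟨Cat_n,Cat_n,Cat_n⟩ ≤ B_n because S = id on ker E ∩
(weight 0) whose dimension is ≥ C(2n,n) − C(2n,n+1) = catalan n (rank–nullity; Ω = EF+FE+H²/2
vanishes there since [E,F] = H) and inserting S thrice into ⟨2^{2n}⟩ restricts to ⟨L,L,L⟩ for any L
on which S = id. [difficulty: L] -/
@[route_item "route-MatrixMultiplication-SpechtRecoupling", crux]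
def ChannelsToCatalan : Prop :=
  CentralChannelsRateFour → CatalanBorderRate

/-- item stmt-MatrixMultiplication-6798 · support · rank 9 · open · by planner
sources: Blaser2013, AlmanDuanVassilevskaWilliamsXuXuZhou2025
[support] CatalanBorderRate → ω(ℂ) = 2: Bini (Blaser2013_thm66_holds.cubic, PROVED) gives ω ≤
log_{Cat_n}(C·16^{(1+ε)n}) for Cat_n ≥ 2; with (n+1)·catalan n = centralBinom n and 4ⁿ ≤
2n·centralBinom n (Mathlib) the right side tends to 2(1+ε); ε → 0 and ω ≥ 2
(Theorems/AsymptoticSpectrumOmegaGeTwo, PROVED) give ω = 2. [difficulty: provable-now] -/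
@[route_item "route-MatrixMultiplication-SpechtRecoupling"]
def CatalanToOmega : Prop :=
  CatalanBorderRate → MatrixMultiplication

/-- item stmt-MatrixMultiplication-6799 · support · rank 9 · open · by planner
sources: GarsiaWallachXinZabrocki2012, BrownVanwilligenburgZabrocki2010, arXiv:0809.3469, BurgisserClausenShokrollahi1997, GoodmanWallachGTM255
[support] Lie localisation: for n ≥ 1 the β-odd part O_n of the central block (β = ε^{⊗2n}|Inv,
symmetric nondegenerate; X^β = JXᵀJ, in indices a ↦ θa = (ā₂,ā₁) with sign (−1)^{#1(a₁)+#0(a₂)}; O_n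
= antisymmetrise all three parties) and the structure tensor of 𝔰𝔬(catalan n) restrict to each other
(hence equal border rank): Tr-pairing of β-odd with β-even vanishes, so O_n(Z,X,Y) = ½⟨Z,[X,Y]⟩ on
𝔰𝔬(Inv_2n,β) ≅ 𝔰𝔬_Cat_n(ℂ). Representation-theoretically O_n = Σ of the channels with λ,μ,ν all of 4
odd parts (Λ²[n,n]); verified exactly for n = 2,3 (Λ² is one isotypic type: [1⁴], [3,1³]).
[difficulty: L] -/
@[route_item "route-MatrixMultiplication-SpechtRecoupling"]
def OddChannelIsSo : Prop :=
  ∀ n : ℕ, 1 ≤ n → let E : Matrix (Fin (2 * n) → Fin 2) (Fin (2 * n) → Fin 2) ℂ := fun w w' => ((Finset.univ.filter fun i : Fin (2 * n) => w' i = 1 ∧ w = Function.update w' i 0).card : ℂ); let H : Matrix (Fin (2 * n) → Fin 2) (Fin (2 * n) → Fin 2) ℂ := Matrix.diagonal fun w => ((Finset.univ.filter fun i : Fin (2 * n) => w i = 0).card : ℂ) - ((Finset.univ.filter fun i : Fin (2 * n) => w i = 1).card : ℂ); let Ω : Matrix (Fin (2 * n) → Fin 2) (Fin (2 * n) → Fin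 2) ℂ := E * E.transpose + E.transpose * E + (1 / 2 : ℂ) • (H * H); let S : Matrix (Fin (2 * n) → Fin 2) (Fin (2 * n) → Fin 2) ℂ := (((List.range n).map fun k : ℕ => (1 : Matrix (Fin (2 * n) → Fin 2) (Fin (2 * n) → Fin 2) ℂ) - (2 * ((n : ℂ) - k) * ((n : ℂ) - k + 1))⁻¹ • Ω)).prod; let B : (Fin (2 * n) → Fin 2 × Fin 2) → (Fin (2 * n) → Fin 2 × Fin 2) → (Fin (2 * n) → Fin 2 × Fin 2) → ℂ := fun a b c => S (fun i => (a i).1) (fun i => (b i).1) * S (fun i => (b i).2) (fun i => (c i).1) * S (fun i => (a i).2) (fun i => (c i).2); let θ : (Fin (2 * n) → Fin 2 × Fin 2) → (Fin (2 * n) → Fin 2 × Fin 2) := fun a i => (1 - (a i).2, 1 - (a i).1); let sg : (Fin (2 * n) → Fin 2 × Fin 2) → ℂ := fun a => (-1 : ℂ) ^ ((Finset.univ.filter fun i : Fin (2 * n) => (a i).1 = 1).card + (Finset.univ.filter fun i : Fin (2 * n) => (a i).2 = 0).card); let O : (Fin (2 * n) → Fin 2 × Fin 2) → (Fin (2 *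 n) → Fin 2 × Fin 2) → (Fin (2 * n) → Fin 2 × Fin 2) → ℂ := fun a b c => (1 / 8 : ℂ) * ((B a b c - sg a * B (θ a) b c) - sg b * (B a (θ b) c - sg a * B (θ a) (θ b) c) - sg c * ((B a b (θ c) - sg a * B (θ a) b (θ c)) - sg b * (B a (θ b) (θ c) - sg a * B (θ a) (θ b) (θ c)))); Literature.Computability.AlgebraicComplexity.TensorRestrictsTo (fun z x y : {p : Fin (catalan n) × Fin (catalan n) // p.1 < p.2} => (((Matrix.single x.1.1 x.1.2 (1 : ℂ) - Matrix.single x.1.2 x.1.1 1) * (Matrix.single y.1.1 y.1.2 (1 : ℂ) - Matrix.single y.1.2 y.1.1 1) - (Matrix.single y.1.1 y.1.2 (1 : ℂ) - Matrix.single y.1.2 y.1.1 1) * (Matrix.single x.1.1 x.1.2 (1 : ℂ) - Matrix.single x.1.2 x.1.1 1) : Matrix (Fin (catalan n)) (Fin (catalan n)) ℂ)) z.1.1 z.1.2) O ∧ Literature.Computability.AlgebraicComplexity.TensorRestrictsTo O (fun z x y : {p : Fin (catalan n) × Fin (catalan n) // p.1 < p.2} => (((Matrix.single x.1.1 x.1.2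 (1 : ℂ) - Matrix.single x.1.2 x.1.1 1) * (Matrix.single y.1.1 y.1.2 (1 : ℂ) - Matrix.single y.1.2 y.1.1 1) - (Matrix.single y.1.1 y.1.2 (1 : ℂ) - Matrix.single y.1.2 y.1.1 1) * (Matrix.single x.1.1 x.1.2 (1 : ℂ) - Matrix.single x.1.2 x.1.1 1) : Matrix (Fin (catalan n)) (Fin (catalan n)) ℂ)) z.1.1 z.1.2)

/-- item stmt-MatrixMultiplication-6800 · support · rank 9 · open · by planner
sources: JelisiejewLandsbergPal2023, arXiv:2205.05713, BurgisserClausenShokrollahi1997, LandsbergOttaviani2015, ConnerGesmundoLandsbergVentura2022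
[support] first finite calibration (card C3 at the first nontrivial central block n = 3 = ⟨5,5,5⟩
under S_6, channel types (6),(4,2),(2,2,2),(3,1,1,1) of dims 1,9,5,10): the odd channel = T_𝔰𝔬₅ ∈
(ℂ¹⁰)^{⊗3} is not of minimal border rank, bR ≥ 11. Expected proof: T_𝔰𝔬₅ is concise (BCS Ex. 14.22)
and 111-sparse (triple intersection = quasi-centroid triples = scalars, dim 1 < 10), so the
111-equations (JelisiejewLandsbergPal2023 §1, Prop 1.1) exclude border rank 10; alternatively a p =
1 Koszul-flattening certificate as in the tree's CGLV certificates. [difficulty: S] -/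
@[route_item "route-MatrixMultiplication-SpechtRecoupling"]
def SoFiveNotMinimal : Prop :=
  11 ≤ Literature.Computability.AlgebraicComplexity.algBorderRank (fun z x y : {p : Fin 5 × Fin 5 // p.1 < p.2} => (((Matrix.single x.1.1 x.1.2 (1 : ℂ) - Matrix.single x.1.2 x.1.1 1) * (Matrix.single y.1.1 y.1.2 (1 : ℂ) - Matrix.single y.1.2 y.1.1 1) - (Matrix.single y.1.1 y.1.2 (1 : ℂ) - Matrix.single y.1.2 y.1.1 1) * (Matrix.single x.1.1 x.1.2 (1 : ℂ) - Matrix.single x.1.2 x.1.1 1) : Matrix (Fin 5) (Fin 5) ℂ)) z.1.1 z.1.2)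

/-- item stmt-MatrixMultiplication-6801 · support · rank 9 · open · by planner
sources: Landsberg2005, HauensteinIkenmeyerLandsberg2013, BurgisserIkenmeyer2011
[support] the card's apolarity lemma in invariant form: for all large N, ⟨2,2,2⟩^{⊗N} is not in the
linear span of the N-th Kronecker powers of tensors of rank ≤ 6 (so no S_N-equivariant decomposition
into Young-orbit sums of rank-one tensors with ≤ 6 orbit parts exists, since such orbit sums are
coefficient extractions of (Σ_{i≤6} t_i s_i)^{⊗N}). Proof: span{S^{⊗N} : R(S) ≤ 6} =
(I(σ₆(Seg))_N)^⊥ inside Sym^N; bR(⟨2,2,2⟩) = 7 (Landsberg2005) gives a homogeneous equation of σ₆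
not vanishing at ⟨2,2,2⟩ (explicitly of degree 20, HauensteinIkenmeyerLandsberg2013), hence N₀ ≤ 20.
[difficulty: M] -/
@[route_item "route-MatrixMultiplication-SpechtRecoupling"]
def PowersOutsideSecantSpan : Prop :=
  ∃ N₀ : ℕ, ∀ N : ℕ, N₀ ≤ N → Literature.Computability.AlgebraicComplexity.kroneckerPow (Literature.Computability.AlgebraicComplexity.matMulTensor ℂ 2 2 2) N ∉ Submodule.span ℂ {t : (Fin N → Fin 2 × Fin 2) → (Fin N → Fin 2 × Fin 2) → (Fin N → Fin 2 × Fin 2) → ℂ | ∃ s : (Fin 2 × Fin 2) → (Fin 2 × Fin 2) → (Fin 2 × Fin 2) → ℂ, Literature.Computability.AlgebraicComplexity.tensorRank s ≤ 6 ∧ t = Literature.Computability.AlgebraicComplexity.kroneckerPow s N}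

/-- item stmt-MatrixMultiplication-6802 · assembly · rank 1 · open · by planner
sources: Blaser2013, ChristandlVranaZuiddam2023
[assembly] CentralChannelsRateFour → ChannelsToCatalan → CatalanToOmega → MatrixMultiplication. -/
@[route_item "route-MatrixMultiplication-SpechtRecoupling"]
def Assembly : Prop :=
  CentralChannelsRateFour → ChannelsToCatalan → CatalanToOmega → MatrixMultiplication

/-! D-0027 §2.1 — DECIDING THEOREM (planner-authored via `route open/edit --closes-file`; by planner-rbadge-MatrixMultiplication-SpechtReco-fb567ed5-g2-0 2026-08-15T16:20:50Z):
its hypotheses are this route's items and its conclusion the sub-problem Statement (glue_lint), and it elaborates with this file. -/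

@[closes "route-MatrixMultiplication-SpechtRecoupling"] theorem closes (hX : CentralChannelsRateFour) (hS : ChannelsToCatalan) : MatrixMultiplication := by
  -- Route glue (D-0027 §2.1): the crux X = CentralChannelsRateFour and the sandwich support item
  -- ChannelsToCatalan give CatalanBorderRate (bR(⟨Cat_n,Cat_n,Cat_n⟩) ≤ C·16^{(1+ε)n}); Bini theorem
  -- (Blaser2013 Thm 6.6, PROVED in the tree: Blaser2013_thm66_holds.cubic) gives
  -- ω·log Cat_n ≤ log⌈C·16^{(1+ε)n}⌉; with 4^n ≤ n^4·Cat_n (Mathlib: four_pow_le_two_mul_self_mul_centralBinom,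
  -- succ_mul_catalan_eq_centralBinom) and log n / n → 0 the ratio tends to 2(1+ε); ε → 0 and ω ≥ 2
  -- (omega_two_le, flattening bound) give ω(ℂ) = 2 = MatrixMultiplication. No sorry, no new axioms.
  have hC : CatalanBorderRate := hS hX
  show Literature.Computability.AlgebraicComplexity.omega ℂ = 2
  refine le_antisymm ?_ (Literature.Computability.AlgebraicComplexity.omega_two_le ℂ)
  refine le_of_forall_pos_le_add fun δ hδ => ?_
  obtain ⟨C, hCn⟩ := hC (δ / 2) (by positivity)
  -- constants
  have hω0 : (0 : ℝ) ≤ Literature.Computability.AlgebraicComplexity.omega ℂ :=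
    le_trans (by norm_num) (Literature.Computability.AlgebraicComplexity.omega_two_le ℂ)
  have hC'1 : (1 : ℝ) ≤ max C 1 := le_max_right _ _
  have hc0 : (0 : ℝ) < Real.log 4 := Real.log_pos (by norm_num)
  have h16 : Real.log 16 = 2 * Real.log 4 := by
    rw [show (16 : ℝ) = (4 : ℝ) ^ (2 : ℕ) by norm_num, Real.log_pow]; norm_num
  -- Catalan facts: monotone, ≥ 2 from n = 2 on, and 4^n ≤ n^4 · Cat_n for n ≥ 2
  have cat_mono : ∀ m : ℕ, catalan m ≤ catalan (m + 1) := by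
    intro m
    rw [catalan_succ']
    have hmem : ((m, 0) : ℕ × ℕ) ∈ Finset.HasAntidiagonal.antidiagonal m :=
      Finset.HasAntidiagonal.mem_antidiagonal.mpr rfl
    calc catalan m = catalan ((m, 0) : ℕ × ℕ).1 * catalan ((m, 0) : ℕ × ℕ).2 := by simp
      _ ≤ ∑ ij ∈ Finset.HasAntidiagonal.antidiagonal m, catalan ij.1 * catalan ij.2 :=
        Finset.single_le_sum (f := fun ij : ℕ × ℕ => catalan ij.1 * catalan ij.2)
          (fun _ _ => Nat.zero_le _) hmem
  have hcat2 : ∀ n : ℕ, 2 ≤ n → 2 ≤ catalan n := by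
    intro n hn
    induction n, hn using Nat.le_induction with
    | base => simp [catalan_two]
    | succ m _ ih => exact ih.trans (cat_mono m)
  have hfour : ∀ n : ℕ, 2 ≤ n → 4 ^ n ≤ n ^ 4 * catalan n := by
    intro n hn
    have h1 := Nat.four_pow_le_two_mul_self_mul_centralBinom n (by omega)
    rw [← succ_mul_catalan_eq_centralBinom] at h1
    have h2 : 2 * n * (n + 1) ≤ n ^ 4 := by
      have h4 : 4 ≤ n * n := Nat.mul_le_mul hn hn
      calc 2 * n * (n + 1) ≤ 2 * n * (n + n) := Nat.mul_le_mul_left _ (by omega)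
        _ = 4 * (n * n) := by ring
        _ ≤ (n * n) * (n * n) := Nat.mul_le_mul_right _ h4
        _ = n ^ 4 := by ring
    calc 4 ^ n ≤ 2 * n * ((n + 1) * catalan n) := h1
      _ = (2 * n * (n + 1)) * catalan n := by ring
      _ ≤ n ^ 4 * catalan n := Nat.mul_le_mul_right _ h2
  -- the per-n inequality from Bini's theorem (Blaser2013 Thm 6.6, proved in the tree)
  have key : ∀ n : ℕ, 2 ≤ n →
      Literature.Computability.AlgebraicComplexity.omega ℂ * ((n : ℝ) * Real.log 4 - 4 * Real.log (n : ℝ)) ≤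
        Real.log (2 * max C 1) + (n : ℝ) * ((1 + δ / 2) * Real.log 16) := by
    intro n hn
    have hN2 : 2 ≤ catalan n := hcat2 n hn
    have hNpos : 0 < catalan n := lt_of_lt_of_le (by norm_num) hN2
    have hn0 : (0 : ℝ) < (n : ℝ) := by exact_mod_cast (lt_of_lt_of_le (by norm_num) hn)
    have hx0 : (0 : ℝ) ≤ (1 + δ / 2) * (n : ℝ) := by positivity
    have hpow1 : (1 : ℝ) ≤ (16 : ℝ) ^ ((1 + δ / 2) * (n : ℝ)) := Real.one_le_rpow (by norm_num) hx0
    have hpow0 : (0 : ℝ) < (16 : ℝ) ^ ((1 + δ / 2) * (n : ℝ)) := by positivity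
    have hA1 : (1 : ℝ) ≤ max C 1 * (16 : ℝ) ^ ((1 + δ / 2) * (n : ℝ)) :=
      one_le_mul_of_one_le_of_one_le hC'1 hpow1
    have hA0 : (0 : ℝ) ≤ max C 1 * (16 : ℝ) ^ ((1 + δ / 2) * (n : ℝ)) := by linarith
    have hr0 : 0 < ⌈max C 1 * (16 : ℝ) ^ ((1 + δ / 2) * (n : ℝ))⌉₊ := Nat.ceil_pos.mpr (by linarith)
    have hbr : Literature.Computability.AlgebraicComplexity.algBorderRank
        (Literature.Computability.AlgebraicComplexity.matMulTensor ℂ (catalan n) (catalan n) (catalan n)) ≤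
          ⌈max C 1 * (16 : ℝ) ^ ((1 + δ / 2) * (n : ℝ))⌉₊ := by
      have h' : (Literature.Computability.AlgebraicComplexity.algBorderRank
          (Literature.Computability.AlgebraicComplexity.matMulTensor ℂ (catalan n) (catalan n) (catalan n)) : ℝ) ≤
            (⌈max C 1 * (16 : ℝ) ^ ((1 + δ / 2) * (n : ℝ))⌉₊ : ℝ) :=
        (hCn n).trans ((mul_le_mul_of_nonneg_right (le_max_left C 1) hpow0.le).trans (Nat.le_ceil _))
      exact_mod_cast h'
    have hω := Literature.Computability.AlgebraicComplexity.Blaser2013_thm66_holds.cubic ℂ hN2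
      (Nat.succ_le_of_lt hr0) hbr
    rw [Real.logb] at hω
    have hN1 : (1 : ℝ) < (catalan n : ℝ) := by exact_mod_cast (lt_of_lt_of_le (by norm_num) hN2)
    have hlogN : 0 < Real.log (catalan n : ℝ) := Real.log_pos hN1
    have h1 : Literature.Computability.AlgebraicComplexity.omega ℂ * Real.log (catalan n : ℝ) ≤
        Real.log (⌈max C 1 * (16 : ℝ) ^ ((1 + δ / 2) * (n : ℝ))⌉₊ : ℝ) :=
      (le_div_iff₀ hlogN).mp hω
    -- upper bound on log r
    have hrR : (⌈max C 1 * (16 : ℝ) ^ ((1 + δ / 2) * (n : ℝ))⌉₊ : ℝ) ≤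
        2 * max C 1 * (16 : ℝ) ^ ((1 + δ / 2) * (n : ℝ)) := by
      have := Nat.ceil_lt_add_one hA0
      linarith
    have hr0R : (0 : ℝ) < (⌈max C 1 * (16 : ℝ) ^ ((1 + δ / 2) * (n : ℝ))⌉₊ : ℝ) := by exact_mod_cast hr0
    have h2 : Real.log (⌈max C 1 * (16 : ℝ) ^ ((1 + δ / 2) * (n : ℝ))⌉₊ : ℝ) ≤
        Real.log (2 * max C 1) + (n : ℝ) * ((1 + δ / 2) * Real.log 16) := by
      calc Real.log (⌈max C 1 * (16 : ℝ) ^ ((1 + δ / 2) * (n : ℝ))⌉₊ : ℝ)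
          ≤ Real.log (2 * max C 1 * (16 : ℝ) ^ ((1 + δ / 2) * (n : ℝ))) := Real.log_le_log hr0R hrR
        _ = Real.log (2 * max C 1) + Real.log ((16 : ℝ) ^ ((1 + δ / 2) * (n : ℝ))) :=
            Real.log_mul (by positivity) hpow0.ne'
        _ = Real.log (2 * max C 1) + (n : ℝ) * ((1 + δ / 2) * Real.log 16) := by
            rw [Real.log_rpow (show (0 : ℝ) < 16 by norm_num)]; ring
    -- lower bound on log (catalan n)
    have h3 : (n : ℝ) * Real.log 4 - 4 * Real.log (n : ℝ) ≤ Real.log (catalan n : ℝ) := by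
      have hcast : (4 : ℝ) ^ n ≤ (n : ℝ) ^ 4 * (catalan n : ℝ) := by exact_mod_cast hfour n hn
      have hlog := Real.log_le_log (by positivity) hcast
      rw [Real.log_pow, Real.log_mul (pow_pos hn0 4).ne' (Nat.cast_pos.mpr hNpos).ne', Real.log_pow] at hlog
      push_cast at hlog
      linarith
    calc Literature.Computability.AlgebraicComplexity.omega ℂ * ((n : ℝ) * Real.log 4 - 4 * Real.log (n : ℝ))
        ≤ Literature.Computability.AlgebraicComplexity.omega ℂ * Real.log (catalan n : ℝ) :=
          mul_le_mul_of_nonneg_left h3 hω0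
      _ ≤ Real.log (⌈max C 1 * (16 : ℝ) ^ ((1 + δ / 2) * (n : ℝ))⌉₊ : ℝ) := h1
      _ ≤ Real.log (2 * max C 1) + (n : ℝ) * ((1 + δ / 2) * Real.log 16) := h2
  -- limits: log n / n → 0, hence the ratio of the two bounds tends to (1 + δ/2) log 16 / log 4 = 2 + δ
  have hlog : Tendsto (fun n : ℕ => Real.log (n : ℝ) / (n : ℝ)) atTop (𝓝 0) := by
    have h : Tendsto (fun x : ℝ => Real.log x / x) atTop (𝓝 0) := by
      simpa using Real.tendsto_pow_log_div_mul_add_atTop 1 0 1 one_ne_zero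
    exact h.comp tendsto_natCast_atTop_atTop
  have hnum : Tendsto (fun n : ℕ => (Real.log (2 * max C 1) + (n : ℝ) * ((1 + δ / 2) * Real.log 16)) / (n : ℝ))
      atTop (𝓝 ((1 + δ / 2) * Real.log 16)) := by
    have h := (tendsto_const_div_atTop_nhds_zero_nat (Real.log (2 * max C 1))).add_const
      ((1 + δ / 2) * Real.log 16)
    rw [zero_add] at h
    refine h.congr' ?_
    filter_upwards [eventually_gt_atTop 0] with n hn
    have hn' : (n : ℝ) ≠ 0 := Nat.cast_ne_zero.mpr hn.ne'
    rw [add_div, mul_div_cancel_left₀ _ hn']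
  have hden : Tendsto (fun n : ℕ => ((n : ℝ) * Real.log 4 - 4 * Real.log (n : ℝ)) / (n : ℝ))
      atTop (𝓝 (Real.log 4)) := by
    have h := (hlog.const_mul 4).const_sub (Real.log 4)
    rw [mul_zero, sub_zero] at h
    refine h.congr' ?_
    filter_upwards [eventually_gt_atTop 0] with n hn
    have hn' : (n : ℝ) ≠ 0 := Nat.cast_ne_zero.mpr hn.ne'
    rw [sub_div, mul_div_cancel_left₀ _ hn', mul_div_assoc]
  have hf : Tendsto (fun n : ℕ => (Real.log (2 * max C 1) + (n : ℝ) * ((1 + δ / 2) * Real.log 16)) /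
      ((n : ℝ) * Real.log 4 - 4 * Real.log (n : ℝ))) atTop (𝓝 ((1 + δ / 2) * Real.log 16 / Real.log 4)) := by
    have h := hnum.div hden hc0.ne'
    refine h.congr' ?_
    filter_upwards [eventually_gt_atTop 0] with n hn
    have hn' : (n : ℝ) ≠ 0 := Nat.cast_ne_zero.mpr hn.ne'
    simp only [Pi.div_apply]
    rw [div_div_div_cancel_right₀ hn']
  have hev : ∀ᶠ n : ℕ in atTop, Literature.Computability.AlgebraicComplexity.omega ℂ ≤
      (Real.log (2 * max C 1) + (n : ℝ) * ((1 + δ / 2) * Real.log 16)) /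
        ((n : ℝ) * Real.log 4 - 4 * Real.log (n : ℝ)) := by
    have hsmall : (0 : ℝ) < Real.log 4 / 8 := by positivity
    filter_upwards [eventually_ge_atTop 2, hlog.eventually (gt_mem_nhds hsmall)] with n hn hln
    have hn0 : (0 : ℝ) < (n : ℝ) := by exact_mod_cast (lt_of_lt_of_le (by norm_num) hn)
    have hln' : Real.log (n : ℝ) < Real.log 4 / 8 * (n : ℝ) := (div_lt_iff₀ hn0).mp hln
    have hpos : (0 : ℝ) < (n : ℝ) * Real.log 4 := mul_pos hn0 hc0
    have hD : (0 : ℝ) < (n : ℝ) * Real.log 4 - 4 * Real.log (n : ℝ) := by linarith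
    exact (le_div_iff₀ hD).mpr (key n hn)
  have hωle := ge_of_tendsto hf hev
  have hval : (1 + δ / 2) * Real.log 16 / Real.log 4 = 2 + δ := by
    calc (1 + δ / 2) * Real.log 16 / Real.log 4 = (2 + δ) * (Real.log 4 / Real.log 4) := by
          rw [h16]; ring
      _ = 2 + δ := by rw [div_self hc0.ne']; ring
  exact hωle.trans hval.le

end Summit.MatrixMultiplication.MatrixMultiplication.Theses.SpechtRecoupling
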